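import Mathlib.Probability.Martingale.Basic
import Mathlib.Probability.Kernel.Composition.MeasureComp
import Mathlib.Probability.Kernel.Composition.MapComap
import Mathlib.MeasureTheory.Integral.IntervalIntegral.Basic
import Mathlib.MeasureTheory.Integral.Prod
import Mathlib.Analysis.Calculus.ContDiff.Basic
import Mathlib.LinearAlgebra.Trace
import Literature.Analysis.FluidPDE.HardSphereDynamics
import HarnessLib

/-!
# Hard spheres with a conservative velocity-exchange noise (Olla–Varadhan–Yau / Liverani–Olla)

Topic `Literature/MathematicalPhysics/KineticTheory` (definition item `defn-BathExchangeDynamics`;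
wanted by the crux `BathReduction` of route `AtomisticToContinuum/EinsteinBath` and by the cruxes
of route `AtomisticToContinuum/VanishingNoise`).

**The object.** `N` hard spheres of diameter `ε` in a geometry `G` (the flat torus
`Literature.Analysis.FluidPDE.Torus.geometry (Fin 3)` is the case of interest) move by the hard-sphere dynamics of
`Literature.Analysis.FluidPDE.HardSphereDynamics` (free flight + elastic collisions) and, *in addition*, the velocities
of every pair `(i, j)` are subject to a random exchange of momentum and kinetic energy which
conserves `v_i + v_j` and `|v_i|² + |v_j|²` — i.e. the pair velocity moves on the `2`-dimensional
(for `d = 3`) *conservation surface* — at a rate `γ ψ(n_{ij}/r)` governed by a smooth function of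
the separation vector `n_{ij} = x_i - x_j` and a strength `γ`. This is the stochastic perturbation of
Olla–Varadhan–Yau 1993, §1 and §2.1 (generator `L_ε + θ(ε) ∑_{α≠β} ψ(ε, x_α - x_β) L_{α,β}`, (2.5)–(2.6):
`L_{1,2} = γ(c) Δ_{Γ_c}` the Laplace–Beltrami operator of the conservation surface `Γ_c ⊆ ℝ⁶`),
of Varadhan's 1992 CIME lectures, §5 (`𝒜_ε = L_ε + θ(ε) ∑ ψ((q^α - q^β)/ε) L_{α,β}`,
`L_{α,β} = ∑_j X_j^* X_j` with vector fields `X_j` tangent to the conservation manifolds) and of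
Liverani–Olla 1996, §1 pp. 405–406 (`X(σ) = ⟨σ, ∂_{p_α} - ∂_{p_β}⟩` with `σ` divergence free and
tangent, (1.3)–(1.4); `L̂_{α,β} = ½ ∑_κ X(σ_κ)²`; `L̂ = ∑_{α,β} χ(q_α - q_β) L̂_{α,β}`), here
superposed on the *collisional* hard-sphere dynamics instead of a smooth Hamiltonian one (the jump
version, exchanging the two momenta at random times, is Braxmeier-Even–Olla 2014, §2).

**The formalisation.** Mathlib has Markov kernels, filtrations and martingales but no stochastic
differential equations, let alone with collisions, so the process cannot be *constructed* here.
Following the library's pattern for such objects (`Literature.Analysis.FluidPDE.HardSphereFlow`,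
`HeatConduction.LangevinChainSemigroup`) the dynamics is a **hypothesis structure**
`BathExchangeDynamics G ε N K ψ r γ` bundling the family of path-space laws `P_z` with the
properties that characterise it; its existence (well-posedness of the martingale problem) is a
separate statement, *not* a field and *not* asserted in this file (no named fact is introduced).

* `PairExchange d` — the datum "kernel of the noise": for each separation vector `n`, an operator
  `K n` on functions of a pair of velocities `(v, w) ∈ ℝ^d × ℝ^d` (a second-order operator along
  the conservation surface, or a jump generator on it). `PairExchange.IsConservative K` records the
  properties making it a *conservative noise of OVY type*: it kills constants, commutes with
  multiplication by functions of the pair invariants `(v + w, |v|² + |w|²)` (this is conservation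
  of pair momentum and energy, LO (1.3)–(1.4)), satisfies the maximum principle along the
  conservation fibre, and is symmetric w.r.t. Lebesgue measure on `ℝ^d × ℝ^d` (LO: `X(σ)^* = -X(σ)`,
  `L̂` selfadjoint), which is what makes Maxwellian/Gibbs states reversible for the noise.
  Constructors: `loExchange σ = ½ ∑_k X(σ_k)²` with `pairField σ f = Df · (σ, -σ)` and the
  Liverani–Olla conditions `IsLiveraniOllaField σ`; `ovyExchange a` (classical kinetic energy:
  `a(c)` times the sum of squares of the rotation fields `rotationField k l` of the relative
  velocity, i.e. a multiple of the Laplace–Beltrami operator of the fibre sphere);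
  `jumpExchange κ f (p) = ∫ (f p' - f p) κ(n, p, dp')` and the momentum swap `swapExchange`
  (`f (w, v) - f (v, w)`), proved conservative (`swapExchange_isConservative`).
* `noiseGenerator G K ψ r γ x φ v = γ ∑_{i ≠ j} ψ(r⁻¹ n_{ij}) · (K n_{ij}) (φ with (v_i, v_j)
  replaced) (v_i, v_j)`, `n_{ij} = G.sepVec x_i x_j` (ordered pairs, as OVY's `∑_{α≠β}`): the
  noise part of the generator acting on smooth test functions `φ` of the VELOCITIES, the positions
  entering as parameters — free streaming and collisions are encoded pathwise (next item), so no
  derivative in the (torus-valued) positions is needed.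
* `IsStochasticHardSphereTrajectory G ε N ω` for a path `ω : ℝ≥0 → Config N d X`: stays in the
  hard-sphere domain, collision (contact) times locally finite, càdlàg, positions continuous and
  equal to the initial position translated by the time integral of the velocity (free streaming
  with a time-dependent velocity), and at each contact time `t > 0` a single pair collides from an
  incoming left limit by the elastic law `collidePair` — the fieldwise analogue of
  `Kinetic.IsHardSphereTrajectory` with "free flight between collisions" replaced by streaming,
  the velocities being now random between collisions. The canonical sample space is the subtype
  `Traj G ε N` of such paths with the σ-algebra generated by the coordinates (design note below),
  its natural filtration `trajFiltration` and the shift `pathShift`.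
* `BathExchangeDynamics G ε N K ψ r γ`: a Markov kernel `law : Config N d X → Measure (Traj G ε N)`
  (the law `P_z` of the process started at `z`), a measurable Liouville-conull `good` set of
  initial data in the hard-sphere domain (as for `HardSphereFlow`: for degenerate noises the
  deterministic pathologies — grazing, multiple collisions — are only Liouville-null), and for
  `z ∈ good`: `P_z(ω_0 = z) = 1`; the simple **Markov property** at deterministic times for the
  natural filtration; and the **martingale problem**: for every smooth compactly supported `φ` of
  the velocities,
  `φ(v_t) - φ(v_0) - ∫₀ᵗ noiseGenerator(x_s) φ (v_s) ds - ∑_{collision times s ≤ t} (φ(v_s) - φ(v_{s-}))`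
  is a `P_z`-martingale (`noiseMartingale`; the collision jumps, which are deterministic functions
  of the left limit, are compensated explicitly, the noise — diffusive or jump — by the time
  integral of the generator). Derived: transition kernels `kernel t` (Markov), path law `pathLaw P₀`
  and time-`t` law `lawAt P₀ t = P₀ ≫= kernel t` from an initial law, invariance `IsInvariant μ`.
  Stationarity / reversibility of the hard-sphere Gibbs measures (Liverani–Olla's setting) is a
  *theorem* about conservative `K` and is deliberately not a field.

## Design notes

* WHY A SUBTYPE OF PATHS. On the full product space `ℝ≥0 → Config N d X` with the product
  σ-algebra, path-regularity events (càdlàg, finitely many collisions, …) are not measurable and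
  have inner measure `0` under every law, so fields of the form `∀ᵐ ω, ω is a trajectory` would
  make the structure uninhabitable by the genuine process. The standard remedy is the canonical
  process on the space of admissible trajectories with the trace σ-algebra (`Subtype.val`-comap,
  Mathlib's instance), which is what `Traj` is.
* WHY VELOCITY TEST FUNCTIONS. Positions are pathwise functionals of the velocities
  (`IsStochasticHardSphereTrajectory.stream`) and collisions are resolved pathwise (`binary`), so the
  martingale problem for `φ(v_t)` with the adapted, position-dependent generator
  `noiseGenerator (x_t)` carries the same information as the one for joint test functions
  `f(x_t, v_t)` (product rule: `x_t` is continuous of bounded variation) while avoiding calculus on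
  the torus.
* `∀ S` VERSUS `∃ S`. As for `LangevinChainSemigroup`, the structure lists properties the process
  HAS; that they CHARACTERISE its law (uniqueness for the martingale problem with collisions) is
  not proved here. A printed theorem about "the" noisy dynamics is faithfully vendored as
  `∃ S : BathExchangeDynamics …, …`; a route assuming `∀ S` assumes in effect uniqueness in law.
* Ordered pairs `i ≠ j` in `noiseGenerator` (OVY (2.6) `∑_{α≠β}`; LO `∑_{α,β}`); the rate is
  `ψ (r⁻¹ • n_{ij})` with `n_{ij}` the geometry's separation vector (minimal image on the torus —
  OVY's periodised `ψ(ε, ·)` of (2.7) is a function of the minimal image, so it can be passed as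
  `ψ` with `r = 1`). `K` may depend on `n_{ij}` (configuration-dependent exchange kernels, as the
  Epstein kernel of route EinsteinBath); OVY/LO kernels ignore it.
* Time is `ℝ≥0`; the compensator is the interval integral over `(0, t) ⊆ ℝ` of
  `s ↦ noiseGenerator … (ω s.toNNReal)`, as in `LangevinChainSemigroup.dynkin`; left limits are
  `Function.leftLim` in the order topology of `ℝ≥0`; the collision sum is a `finsum` (the set is
  finite on trajectories).
* COLLISION RULE ONLY FOR `t > 0` (revision 2). The first landed version imposed `binary` at every
  contact time including `t = 0`, where `Function.leftLim ω 0 = ω 0`; this excluded every path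
  STARTING at a post-collisional contact configuration. But the orbit of a good datum passes
  through such configurations at its collision times `s`, and the Markov identity at time `s`
  forces `law (ω s)` to be carried by the shifted path, which starts there; with the rule at `t = 0`
  no probability measure on `Traj` can do this (the shifted path is separated from `Traj` by a
  countable-coordinate cylinder), so neither the deterministic flow (`γ = 0`) nor any dynamics with
  a collision at a fixed time of positive probability could inhabit the structure. Exempting `t = 0`
  repairs this and changes nothing else: a contact at a positive time of a path is a collision.
* `law` OUTSIDE `good`. The fields constrain `law z` directly only for `z ∈ good`; at other points
  (e.g. contact configurations reached at collision times) `law` is constrained only through the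
  Markov identity from good starts, i.e. `P_z`-almost surely along the process. Consumers should
  quantify over `z ∈ S.good` (Liouville-a.e. `z`, `ae_mem_good`).
* Mathlib/Literature reuse: `Config`, `Geometry`, `hardSphereDomain`, `contactSet`, `IsIncoming`,
  `collidePair`, `liouville` (HardSpherePhaseSpace); `ProbabilityTheory.Kernel`, `IsMarkovKernel`,
  `Kernel.map`, `Measure.bind`, `MeasureTheory.Filtration`, `MeasureTheory.Martingale`,
  `Function.leftLim`, `intervalIntegral`, `fderiv`, `LinearMap.trace`. Nothing is redefined
  (declaration search `noise|exchange|OVY` over Mathlib + Literature: no dynamics of this kind —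
  `IsOVYKineticEnergy` of `Barriers/AtomisticToContinuum/HighMomentumCutoff` is the unrelated class
  of OVY kinetic energies; the nearest interfaces are `HeatConduction.LangevinChainSemigroup`
  (smooth SDE, no collisions) and `Probability.Process.IsBrownianVec`).

## References

* S. Olla, S. R. S. Varadhan, H.-T. Yau, *Hydrodynamical limit for a Hamiltonian system with weak
  noise*, Comm. Math. Phys. 155 (1993) 523–560, §1 (p. 525), §2.1 (pp. 525–527, (2.4)–(2.7)).
  [OllaVaradhanYau1993]
* S. R. S. Varadhan, *Entropy methods in hydrodynamic scaling*, in: Nonequilibrium Problems in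
  Many-Particle Systems (Montecatini 1992), LNM 1551 (1993), §5 (the operator `𝒜_ε`).
  [Varadhan1993EntropyMethods]
* C. Liverani, S. Olla, *Ergodicity in infinite Hamiltonian systems with conservative noise*,
  Probab. Theory Relat. Fields 106 (1996) 401–445, §1 pp. 405–406 ((1.3)–(1.5), `X(σ)`, `L̂`).
  [LiveraniOlla1996]
* N. Braxmeier-Even, S. Olla, *Hydrodynamic limit for a Hamiltonian system with boundary
  conditions and conservative noise*, ARMA 213 (2014), §2 (the jump noise `S_N`).
  [BraxmeierEvenOlla2014]
-/

noncomputable section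

open MeasureTheory ProbabilityTheory Filter Topology Set Function
open scoped NNReal ENNReal InnerProductSpace

namespace Literature.MathematicalPhysics.KineticTheory

open Literature.Analysis.FluidPDE

variable {d : Type*} [Fintype d]

/-! ### Pair velocities, their invariants and the conservation fibre -/

/-- The velocities `(v, w) ∈ ℝ^d × ℝ^d` of a pair of particles (OVY 1993 §2.1: "two sets of
momenta … constituting `ℝ³ × ℝ³ = ℝ⁶`"). [cite: OllaVaradhanYau1993, §2.1] -/
abbrev PairVel (d : Type*) [Fintype d] : Type _ := EuclideanSpace ℝ d × EuclideanSpace ℝ d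

/-- The conserved quantities of a pair exchange: total momentum `v + w` and (twice the) kinetic
energy `|v|² + |w|²` (OVY 1993 (2.4), with the classical kinetic energy `φ(p) = |p|²/2`; LO 1996
(1.3)). [cite: OllaVaradhanYau1993, §2.1 (2.4)] -/
def pairInvariants (p : PairVel d) : EuclideanSpace ℝ d × ℝ :=
  (p.1 + p.2, ‖p.1‖ ^ 2 + ‖p.2‖ ^ 2)

/-- Unfolding lemma for `pairInvariants`. [folklore] -/
theorem pairInvariants_apply (p : PairVel d) :
    pairInvariants p = (p.1 + p.2, ‖p.1‖ ^ 2 + ‖p.2‖ ^ 2) := rfl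

/-- Exchanging the two velocities does not change the pair invariants. [folklore] -/
@[simp]
theorem pairInvariants_swap (p : PairVel d) : pairInvariants p.swap = pairInvariants p := by
  simp only [pairInvariants, Prod.fst_swap, Prod.snd_swap, Prod.mk.injEq]
  exact ⟨add_comm _ _, add_comm _ _⟩

/-- The conservation fibre (OVY's hypersurface `Γ_c`, LO (1.3)) through `p`: the pair velocities
with the same total momentum and kinetic energy as `p`; for `d = 3` a `2`-sphere if `v ≠ w` (in the
relative velocity `v - w`, at fixed `v + w` and `|v - w|`), a point if `v = w`. [cite: OllaVaradhanYau1993, §2.1 (2.4)] -/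
def pairFibre (p : PairVel d) : Set (PairVel d) :=
  {p' | pairInvariants p' = pairInvariants p}

/-- Membership in the conservation fibre. [folklore] -/
theorem mem_pairFibre {p p' : PairVel d} : p' ∈ pairFibre p ↔ pairInvariants p' = pairInvariants p :=
  Iff.rfl

/-- Every pair velocity lies on its own fibre. [folklore] -/
@[simp]
theorem self_mem_pairFibre (p : PairVel d) : p ∈ pairFibre p := rfl

/-- The swapped pair lies on the same fibre. [folklore] -/
@[simp]
theorem swap_mem_pairFibre (p : PairVel d) : p.swap ∈ pairFibre p :=
  pairInvariants_swap p

/-! ### Pair exchange operators (the "kernel" of the noise) -/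

/-- A **pair exchange operator**: for each separation vector `n = x_i - x_j` of the pair, a
(pre)generator `K n` acting on functions of the pair velocities `(v_i, v_j)` — OVY's `L_{α,β}`
(a second-order elliptic operator along the conservation surface, (2.5)), LO's `L̂_{α,β}` (1.5), or
a jump generator on the fibre (Braxmeier-Even–Olla §2). The dependence on `n` allows
configuration-dependent kernels; OVY/LO operators ignore it. A bare type: the properties making it
a conservative noise are `PairExchange.IsConservative`. [cite: OllaVaradhanYau1993, §2.1 (2.5)–(2.6)] -/
abbrev PairExchange (d : Type*) [Fintype d] : Type _ :=
  EuclideanSpace ℝ d → (PairVel d → ℝ) → (PairVel d → ℝ)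

/-- A pair exchange operator is a **conservative noise of Olla–Varadhan–Yau type** when, for every
separation vector `n`: it kills constants (Markov generator) and is linear; it commutes with multiplication by
smooth functions of the pair invariants `(v + w, |v|² + |w|²)` — it acts along the conservation
fibres only, which is LO's tangency (1.3)–(1.4) "which will imply the conservation of energy and
momenta with respect to the stochastic dynamics"; it satisfies the maximum principle along the
fibre (second-order / jump character); and it is symmetric with respect to Lebesgue measure on
`ℝ^d × ℝ^d` on smooth compactly supported functions (OVY: "`L_{1,2}` is clearly selfadjoint with
respect to Lebesgue measure on `ℝ⁶`"; LO: `X(σ)^* = -X(σ)`, `L̂` selfadjoint), whence reversibility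
of the Maxwellians. An abstraction of the printed operators' properties, stated on smooth test
functions. [cite: LiveraniOlla1996, §1 pp. 405–406 (1.3)–(1.5)] -/
structure PairExchange.IsConservative (K : PairExchange d) : Prop where
  /-- `K n c = 0` for constants `c`. -/
  apply_const : ∀ (n : EuclideanSpace ℝ d) (c : ℝ), K n (fun _ => c) = 0
  /-- `K n` is linear on smooth compactly supported functions. -/
  linear : ∀ (n : EuclideanSpace ℝ d) (a : ℝ) (f g : PairVel d → ℝ),
    ContDiff ℝ (⊤ : ℕ∞) f → HasCompactSupport f → ContDiff ℝ (⊤ : ℕ∞) g → HasCompactSupport g →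
      K n (fun p => a * f p + g p) = fun p => a * K n f p + K n g p
  /-- `K n` commutes with multiplication by smooth functions of the pair invariants. -/
  mul_invariants : ∀ (n : EuclideanSpace ℝ d) (h : EuclideanSpace ℝ d × ℝ → ℝ) (f : PairVel d → ℝ),
    ContDiff ℝ (⊤ : ℕ∞) h → ContDiff ℝ (⊤ : ℕ∞) f →
      K n (fun p => h (pairInvariants p) * f p) = fun p => h (pairInvariants p) * K n f p
  /-- Maximum principle along the fibre: at a fibrewise maximum of `f`, `K n f ≤ 0`. -/
  maximum_principle : ∀ (n : EuclideanSpace ℝ d) (f : PairVel d → ℝ) (p₀ : PairVel d),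
    ContDiff ℝ (⊤ : ℕ∞) f → (∀ p ∈ pairFibre p₀, f p ≤ f p₀) → K n f p₀ ≤ 0
  /-- Symmetry with respect to Lebesgue measure on `ℝ^d × ℝ^d`. -/
  symmetric : ∀ (n : EuclideanSpace ℝ d) (f g : PairVel d → ℝ),
    ContDiff ℝ (⊤ : ℕ∞) f → HasCompactSupport f → ContDiff ℝ (⊤ : ℕ∞) g → HasCompactSupport g →
      ∫ p, K n f p * g p = ∫ p, f p * K n g p

/-! #### Second-order (Liverani–Olla) exchange operators -/

/-- The first-order operator `X(σ) f (v, w) = ⟨σ(v, w), (∂_v - ∂_w) f⟩ = Df(v,w) · (σ, -σ)` of a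
field `σ : ℝ^d × ℝ^d → ℝ^d` (LO 1996 §1 p. 405, `X(σ) = ⟨σ, D⟩`, `D = ∂_{p_α} - ∂_{p_β}`); `fderiv`
junk (`0`) where `f` is not differentiable. [cite: LiveraniOlla1996, §1 p. 405] -/
def pairField (σ : PairVel d → EuclideanSpace ℝ d) (f : PairVel d → ℝ) (p : PairVel d) : ℝ :=
  fderiv ℝ f p (σ p, -σ p)

/-- Unfolding lemma for `pairField`. [folklore] -/
@[simp]
theorem pairField_apply (σ : PairVel d → EuclideanSpace ℝ d) (f : PairVel d → ℝ) (p : PairVel d) :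
    pairField σ f p = fderiv ℝ f p (σ p, -σ p) := rfl

/-- `X(σ)` kills constants. [folklore] -/
@[simp]
theorem pairField_const (σ : PairVel d → EuclideanSpace ℝ d) (c : ℝ) :
    pairField σ (fun _ => c) = 0 := by
  funext p
  simp [pairField]

/-- The **Liverani–Olla exchange operator** of a finite family of fields `σ_k` (possibly depending
on the separation vector `n`): `L̂ f = ½ ∑_k X(σ_k)(X(σ_k) f)` (LO 1996 §1 p. 406,
`L̂_{α,β} = -½ ∑_κ X(σ_κ)^* X(σ_κ) = ½ ∑_κ X(σ_κ)²`; Varadhan 1993 §5, `L_{α,β} = ∑_j X_j^* X_j` up to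
sign convention). [cite: LiveraniOlla1996, §1 p. 406] -/
def loExchange {ι : Type*} [Fintype ι] (σ : ι → EuclideanSpace ℝ d → PairVel d → EuclideanSpace ℝ d) :
    PairExchange d :=
  fun n f p => 2⁻¹ * ∑ k, pairField (σ k n) (pairField (σ k n) f) p

/-- Unfolding lemma for `loExchange`. [folklore] -/
theorem loExchange_apply {ι : Type*} [Fintype ι]
    (σ : ι → EuclideanSpace ℝ d → PairVel d → EuclideanSpace ℝ d) (n : EuclideanSpace ℝ d)
    (f : PairVel d → ℝ) (p : PairVel d) :
    loExchange σ n f p = 2⁻¹ * ∑ k, pairField (σ k n) (pairField (σ k n) f) p := rfl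

/-- The Liverani–Olla exchange operator kills constants. [folklore] -/
@[simp]
theorem loExchange_const {ι : Type*} [Fintype ι]
    (σ : ι → EuclideanSpace ℝ d → PairVel d → EuclideanSpace ℝ d) (n : EuclideanSpace ℝ d) (c : ℝ) :
    loExchange σ n (fun _ => c) = 0 := by
  funext p
  simp [loExchange]

/-- The **Liverani–Olla conditions** on the fields `σ_k` of a second-order exchange (LO 1996 §1
pp. 405–406): each `σ_k(n, ·)` is smooth, *tangent* to the conservation surfaces —
`⟨σ, v - w⟩ = 0` ((1.4) with the classical kinetic energy, `∇φ(p) = p`; tangency to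
`v + w = const` is built into `X(σ)`) — and has *null divergence* `⟨D, σ⟩ = ∑_i (∂_{v_i} - ∂_{w_i}) σ_i
= 0`, i.e. the trace of `δ ↦ Dσ(v,w)(δ, -δ)` vanishes (this gives `X(σ)^* = -X(σ)`).
[cite: LiveraniOlla1996, §1 pp. 405–406 (1.3)–(1.4)] -/
structure IsLiveraniOllaField {ι : Type*} (σ : ι → EuclideanSpace ℝ d → PairVel d → EuclideanSpace ℝ d) :
    Prop where
  /-- smoothness of each field -/
  smooth : ∀ k n, ContDiff ℝ (⊤ : ℕ∞) (σ k n)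
  /-- tangency to the energy surface: `⟨σ(v, w), v - w⟩ = 0` -/
  tangent : ∀ k n (p : PairVel d), ⟪σ k n p, p.1 - p.2⟫_ℝ = 0
  /-- null divergence with respect to `D = ∂_v - ∂_w` -/
  divFree : ∀ k n (p : PairVel d),
    LinearMap.trace ℝ (EuclideanSpace ℝ d)
      ((fderiv ℝ (σ k n) p).toLinearMap ∘ₗ
        (LinearMap.id.prod (-LinearMap.id) : EuclideanSpace ℝ d →ₗ[ℝ] PairVel d)) = 0

/-- The rotation field of the relative velocity in the `(k, l)` coordinate plane:
`σ_{kl}(v, w) = u_k e_l - u_l e_k`, `u = v - w`; these fields are tangent and divergence free and,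
for the classical kinetic energy, span the tangent space of the fibre sphere (they generate the
rotations of `v - w` at fixed `v + w`, `|v - w|`), so that `½ ∑_{k,l} X(σ_{kl})²` is a multiple of
the Laplace–Beltrami operator of the fibre — OVY's canonical choice (2.5). [cite: OllaVaradhanYau1993, §2.1 (2.5)] -/
def rotationField [DecidableEq d] (k l : d) (p : PairVel d) : EuclideanSpace ℝ d :=
  (p.1 k - p.2 k) • EuclideanSpace.single l (1 : ℝ) - (p.1 l - p.2 l) • EuclideanSpace.single k (1 : ℝ)

/-- The **Olla–Varadhan–Yau exchange operator** for the classical kinetic energy with rate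
function `a` of the pair invariants: `a(c) · ½ ∑_{k,l} X(σ_{kl})² f`, a multiple (depending on the
invariants `c` only) of `γ(c) Δ_{Γ_c}`, the Laplace–Beltrami operator of the conservation surface
(OVY 1993 (2.5): "We can choose in fact a more general operator `L_{12}`, as long as it is
elliptic of second order acting only on tangential directions of `Γ_c`"). OVY and LO state their
theorems for NON-quadratic kinetic energies (OVY (2.2)(iii), LO case (NG)); this is the
transcription of (2.5) to `φ(p) = |p|²/2`, the kinetic energy of hard spheres (LO's case (G)).
[cite: OllaVaradhanYau1993, §2.1 (2.5)] -/
def ovyExchange [DecidableEq d] (a : EuclideanSpace ℝ d × ℝ → ℝ) : PairExchange d :=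
  fun _ f p => a (pairInvariants p) *
    (2⁻¹ * ∑ kl : d × d, pairField (rotationField kl.1 kl.2) (pairField (rotationField kl.1 kl.2) f) p)

/-- `ovyExchange a` is the rate `a` times the Liverani–Olla operator of the rotation fields.
[folklore] -/
theorem ovyExchange_apply [DecidableEq d] (a : EuclideanSpace ℝ d × ℝ → ℝ) (n : EuclideanSpace ℝ d)
    (f : PairVel d → ℝ) (p : PairVel d) :
    ovyExchange a n f p =
      a (pairInvariants p) * loExchange (fun (kl : d × d) (_ : EuclideanSpace ℝ d) => rotationField kl.1 kl.2) n f p :=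
  rfl

/-! #### Jump exchange operators -/

/-- The **jump exchange operator** of a family of (finite) measures `κ n p` on pair velocities:
`K n f (p) = ∫ (f p' - f p) κ(n, p)(dp')` — the pair velocity jumps to `p'` at rate `κ(n, p, dp')`;
it is conservative when each `κ n p` is carried by the fibre `pairFibre p` and symmetric (OVY 1993
§1: the particles "exchange velocities randomly … in such a way as to conserve the combined momenta
and energy of the pair"; Braxmeier-Even–Olla 2014 §2, `S_N`). [cite: BraxmeierEvenOlla2014, §2] -/
def jumpExchange (κ : EuclideanSpace ℝ d → PairVel d → Measure (PairVel d)) : PairExchange d :=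
  fun n f p => ∫ p', (f p' - f p) ∂κ n p

/-- Unfolding lemma for `jumpExchange`. [folklore] -/
theorem jumpExchange_apply (κ : EuclideanSpace ℝ d → PairVel d → Measure (PairVel d))
    (n : EuclideanSpace ℝ d) (f : PairVel d → ℝ) (p : PairVel d) :
    jumpExchange κ n f p = ∫ p', (f p' - f p) ∂κ n p := rfl

/-- The **momentum swap** `K f (v, w) = f (w, v) - f (v, w)`: the two particles exchange their
velocities at rate one (the `d`-dimensional version of Braxmeier-Even–Olla's `S_N`,
`f(r, p^{i,i+1}) - f(r, p)`); the jump exchange of the Dirac kernel at the swapped pair. A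
degenerate (non-elliptic) but conservative noise. [cite: BraxmeierEvenOlla2014, §2] -/
def swapExchange : PairExchange d :=
  fun _ f p => f p.swap - f p

/-- Unfolding lemma for `swapExchange`. [folklore] -/
@[simp]
theorem swapExchange_apply (n : EuclideanSpace ℝ d) (f : PairVel d → ℝ) (p : PairVel d) :
    swapExchange n f p = f p.swap - f p := rfl

/-- The momentum swap is the jump exchange of the Dirac kernel at the swapped pair. [folklore] -/
theorem swapExchange_eq_jumpExchange :
    (swapExchange : PairExchange d) = jumpExchange fun _ p => Measure.dirac p.swap := by
  funext n f p
  simp [jumpExchange, swapExchange]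

/-- **The momentum swap is a conservative noise** (non-vacuity of `PairExchange.IsConservative`):
it kills constants, is linear, commutes with functions of the invariants (`pairInvariants_swap`), satisfies the
fibrewise maximum principle (`swap_mem_pairFibre`) and is symmetric w.r.t. Lebesgue measure (the
swap preserves `volume` on `ℝ^d × ℝ^d`, `integral_prod_swap`). [folklore] -/
theorem swapExchange_isConservative : (swapExchange : PairExchange d).IsConservative where
  apply_const n c := by
    funext p
    simp
  linear n a f g _ _ _ _ := by
    funext p
    simp only [swapExchange_apply]
    ring
  mul_invariants n h f _ _ := by
    funext p
    simp only [swapExchange_apply, pairInvariants_swap]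
    ring
  maximum_principle n f p₀ _ hmax := by
    simp only [swapExchange_apply, sub_nonpos]
    exact hmax _ (swap_mem_pairFibre p₀)
  symmetric n f g hf hfc hg hgc := by
    have hfc' : Continuous f := hf.continuous
    have hgc' : Continuous g := hg.continuous
    have h1 : Integrable (fun p : PairVel d => f p.swap * g p) :=
      ((hfc'.comp continuous_swap).mul hgc').integrable_of_hasCompactSupport hgc.mul_left
    have h2 : Integrable (fun p : PairVel d => f p * g p) :=
      (hfc'.mul hgc').integrable_of_hasCompactSupport hgc.mul_left
    have h3 : Integrable (fun p : PairVel d => f p * g p.swap) :=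
      (hfc'.mul (hgc'.comp continuous_swap)).integrable_of_hasCompactSupport hfc.mul_right
    have hsw : ∫ p : PairVel d, f p.swap * g p = ∫ p : PairVel d, f p * g p.swap := by
      have h := integral_prod_swap (μ := (volume : Measure (EuclideanSpace ℝ d)))
        (ν := (volume : Measure (EuclideanSpace ℝ d))) (fun p : PairVel d => f p * g p.swap)
      simp only [Prod.swap_swap] at h
      rw [← Measure.volume_eq_prod] at h
      exact h
    simp only [swapExchange_apply, sub_mul, mul_sub]
    rw [integral_sub h1 h2, integral_sub h3 h2, hsw]

/-! ### The `N`-particle noise generator -/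

section Noise

variable {X : Type*} {N : ℕ}

/-- Replace the velocities of particles `i` and `j` in the velocity configuration `v` by the pair
`p = (p.1, p.2)` (particle `i` gets `p.1`, then particle `j` gets `p.2`). [folklore] -/
def setPairVel (v : Fin N → EuclideanSpace ℝ d) (i j : Fin N) (p : PairVel d) :
    Fin N → EuclideanSpace ℝ d :=
  Function.update (Function.update v i p.1) j p.2

/-- Setting the pair to its current value does nothing. [folklore] -/
@[simp]
theorem setPairVel_self (v : Fin N → EuclideanSpace ℝ d) (i j : Fin N) :
    setPairVel v i j (v i, v j) = v := by
  simp [setPairVel]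

/-- The **noise generator** of the `N`-particle system acting on a test function `φ` of the
velocities, at positions `x`: `γ ∑_{i ≠ j} ψ(r⁻¹ n_{ij}) (K n_{ij}) (p ↦ φ(v with (v_i, v_j) := p))
(v_i, v_j)` with `n_{ij} = G.sepVec x_i x_j` the separation vector of the pair — OVY 1993 (2.6)
`θ(ε) ∑_{α≠β} ψ(ε, x_α - x_β) L_{α,β}`, Varadhan 1993 §5 `θ(ε) ∑ ψ((q^α - q^β)/ε) L_{α,β}`, LO 1996
`∑_{α,β} χ(q_α - q_β) L̂_{α,β}`: strength `γ`, spatial scale `r`, smooth rate profile `ψ`, pair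
operator `K`. Ordered pairs. [cite: OllaVaradhanYau1993, §2.1 (2.6)] -/
def noiseGenerator (G : Geometry d X) (K : PairExchange d) (ψ : EuclideanSpace ℝ d → ℝ) (r γ : ℝ)
    (x : Fin N → X) (φ : (Fin N → EuclideanSpace ℝ d) → ℝ) (v : Fin N → EuclideanSpace ℝ d) : ℝ :=
  γ * ∑ i : Fin N, ∑ j ∈ Finset.univ.filter (fun j => j ≠ i),
    ψ (r⁻¹ • G.sepVec (x i) (x j)) *
      K (G.sepVec (x i) (x j)) (fun p => φ (setPairVel v i j p)) (v i, v j)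

/-- Unfolding lemma for `noiseGenerator`. [folklore] -/
theorem noiseGenerator_apply (G : Geometry d X) (K : PairExchange d) (ψ : EuclideanSpace ℝ d → ℝ)
    (r γ : ℝ) (x : Fin N → X) (φ : (Fin N → EuclideanSpace ℝ d) → ℝ) (v : Fin N → EuclideanSpace ℝ d) :
    noiseGenerator G K ψ r γ x φ v =
      γ * ∑ i : Fin N, ∑ j ∈ Finset.univ.filter (fun j => j ≠ i),
        ψ (r⁻¹ • G.sepVec (x i) (x j)) *
          K (G.sepVec (x i) (x j)) (fun p => φ (setPairVel v i j p)) (v i, v j) := rfl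

/-- At zero strength there is no noise. [folklore] -/
@[simp]
theorem noiseGenerator_zero_strength (G : Geometry d X) (K : PairExchange d)
    (ψ : EuclideanSpace ℝ d → ℝ) (r : ℝ) (x : Fin N → X) (φ : (Fin N → EuclideanSpace ℝ d) → ℝ)
    (v : Fin N → EuclideanSpace ℝ d) : noiseGenerator G K ψ r 0 x φ v = 0 := by
  simp [noiseGenerator]

/-- A conservative-type pair operator that kills constants gives a noise generator that kills
constants. [folklore] -/
theorem noiseGenerator_const (G : Geometry d X) {K : PairExchange d}
    (hK : ∀ (n : EuclideanSpace ℝ d) (c : ℝ), K n (fun _ => c) = 0) (ψ : EuclideanSpace ℝ d → ℝ)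
    (r γ : ℝ) (x : Fin N → X) (c : ℝ) (v : Fin N → EuclideanSpace ℝ d) :
    noiseGenerator G K ψ r γ x (fun _ => c) v = 0 := by
  simp [noiseGenerator, hK]

end Noise

/-! ### Stochastic hard-sphere trajectories and the canonical path space -/

section Paths

variable {X : Type*} {N : ℕ}

/-- The contact (collision) times of a path `ω : ℝ≥0 → Config N d X`: times at which some pair
`i ≠ j` is in contact (the `ℝ≥0`-indexed twin of `Kinetic.collisionTimes`, GST 2013 §4.1).
[cite: GST2013, §4.1] -/
def pathCollisionTimes (G : Geometry d X) (ε : ℝ) (ω : ℝ≥0 → Config N d X) : Set ℝ≥0 :=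
  {t | ∃ i j : Fin N, i ≠ j ∧ ω t ∈ contactSet G N ε i j}

/-- Membership in the set of contact times of a path. [folklore] -/
theorem mem_pathCollisionTimes {G : Geometry d X} {ε : ℝ} {ω : ℝ≥0 → Config N d X} {t : ℝ≥0} :
    t ∈ pathCollisionTimes G ε ω ↔ ∃ i j : Fin N, i ≠ j ∧ ω t ∈ contactSet G N ε i j :=
  Iff.rfl

/-- The shift of a path by `s`: `(θ_s ω)(t) = ω(s + t)`. [folklore] -/
def pathShift (s : ℝ≥0) (ω : ℝ≥0 → Config N d X) : ℝ≥0 → Config N d X :=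
  fun t => ω (s + t)

omit [Fintype d] in
/-- Unfolding lemma for the path shift. [folklore] -/
@[simp]
theorem pathShift_apply (s : ℝ≥0) (ω : ℝ≥0 → Config N d X) (t : ℝ≥0) :
    pathShift s ω t = ω (s + t) := rfl

omit [Fintype d] in
/-- Shifting by `0` does nothing. [folklore] -/
@[simp]
theorem pathShift_zero (ω : ℝ≥0 → Config N d X) : pathShift 0 ω = ω := by
  funext t
  simp

variable [TopologicalSpace X]

/-- `ω : ℝ≥0 → Config N d X` is a **stochastic hard-sphere trajectory** of `N` spheres of diameter
`ε` in the geometry `G`: the admissible sample paths of the hard-sphere dynamics with a velocity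
noise. Fieldwise analogue of `Kinetic.IsHardSphereTrajectory` (GST 2013 §4.1, Def. 4.1.2; CIP 1994
§4.2): the path stays in the hard-sphere domain, its contact times are locally finite, it is
càdlàg (right-continuous with left limits), positions are continuous and obtained from the
velocities by streaming, `x_i(t) = x_i(s) + ∫ₛᵗ v_i` (free flight with the now time-dependent
velocity), and at a contact time `t > 0` exactly one pair is in contact, its left limit is incoming
and the value is the elastic reflection `collidePair` of the left limit (binary, non-grazing
collisions; the path is right-continuous at collisions). Time `0` is exempt from the collision
rule so that a path may start at a post-collisional contact configuration (the Markov shift at a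
collision time produces such paths; pre-collisional contact data, from which no right-continuous
path in the domain issues, are simply not starting points). Between collisions the velocities are
unconstrained here — they are governed by the martingale problem of `BathExchangeDynamics`. An
adaptation of the deterministic notion; not a printed definition. [folklore] -/
structure IsStochasticHardSphereTrajectory (G : Geometry d X) (ε : ℝ) (N : ℕ)
    (ω : ℝ≥0 → Config N d X) : Prop where
  /-- The path stays in the hard-sphere domain `D_ε^N`. -/
  mem : ∀ t, ω t ∈ hardSphereDomain G N ε
  /-- Contact times are locally finite. -/
  locFinite : ∀ T : ℝ≥0, (pathCollisionTimes G ε ω ∩ Set.Iic T).Finite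
  /-- The path is right-continuous. -/
  rightContinuous : ∀ t, ContinuousWithinAt ω (Set.Ici t) t
  /-- The path has left limits at positive times. -/
  leftLim_exists : ∀ t, 0 < t → ∃ l, Tendsto ω (𝓝[<] t) (𝓝 l)
  /-- Positions are continuous in time. -/
  pos_continuous : ∀ i, Continuous fun t => (ω t i).1
  /-- Streaming: positions are the time integrals of the velocities. -/
  stream : ∀ (i : Fin N) (s t : ℝ≥0), s ≤ t →
    (ω t i).1 = G.translate ((ω s i).1) (∫ τ in (s : ℝ)..(t : ℝ), (ω τ.toNNReal i).2)
  /-- At a positive contact time a single pair collides, from an incoming left limit, by the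
  elastic law (time `0` is excluded: a path may START at a post-collisional contact
  configuration, e.g. the shifted path `θ_s ω` at a collision time `s`). -/
  binary : ∀ t (i j : Fin N), 0 < t → i ≠ j → ω t ∈ contactSet G N ε i j →
    (∀ i' j' : Fin N, i' ≠ j' → ω t ∈ contactSet G N ε i' j' →
      ({i', j'} : Finset (Fin N)) = {i, j}) ∧
    IsIncoming G (Function.leftLim ω t) i j ∧ ω t = collidePair G i j (Function.leftLim ω t)

/-- The **canonical path space** of the noisy hard-sphere dynamics: the stochastic hard-sphere
trajectories, with the σ-algebra generated by the coordinate maps (the trace of the product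
σ-algebra, Mathlib's `Subtype` instance). [folklore] -/
abbrev Traj (G : Geometry d X) (ε : ℝ) (N : ℕ) : Type _ :=
  {ω : ℝ≥0 → Config N d X // IsStochasticHardSphereTrajectory G ε N ω}

/-- The sum of the collision jumps of `φ(velocities)` along the path up to time `t`:
`∑_{contact times 0 < s ≤ t} (φ(v_s) - φ(v_{s-}))` (a `finsum`; the set is finite on a
stochastic hard-sphere trajectory). [folklore] -/
def collisionJumps (G : Geometry d X) (ε : ℝ) (φ : (Fin N → EuclideanSpace ℝ d) → ℝ)
    (ω : ℝ≥0 → Config N d X) (t : ℝ≥0) : ℝ :=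
  ∑ᶠ s ∈ pathCollisionTimes G ε ω ∩ Set.Ioc 0 t,
    (φ (Config.vel (ω s)) - φ (Config.vel (Function.leftLim ω s)))

/-- **The martingale of the noise** tested on `φ`: `M^φ_t(ω) = φ(v_t) - φ(v_0) -
∫₀ᵗ noiseGenerator G K ψ r γ (x_s) φ (v_s) ds - ∑_{contact times s ≤ t} (φ(v_s) - φ(v_{s-}))`
— Dynkin's martingale for the velocity process, the deterministic collision jumps being removed
explicitly and the noise compensated by its generator (OVY 1993 §2.1 (2.6): the noisy generator is
the Liouville operator plus the exchange operator; the martingale-problem formulation of a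
generator is standard). [folklore] -/
def noiseMartingale (G : Geometry d X) (ε : ℝ) (K : PairExchange d) (ψ : EuclideanSpace ℝ d → ℝ)
    (r γ : ℝ) (φ : (Fin N → EuclideanSpace ℝ d) → ℝ) (ω : ℝ≥0 → Config N d X) (t : ℝ≥0) : ℝ :=
  φ (Config.vel (ω t)) - φ (Config.vel (ω 0)) -
    (∫ s in (0 : ℝ)..(t : ℝ),
      noiseGenerator G K ψ r γ (Config.pos (ω s.toNNReal)) φ (Config.vel (ω s.toNNReal))) -
    collisionJumps G ε φ ω t

/-- At time `0` the noise martingale vanishes. [folklore] -/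
@[simp]
theorem noiseMartingale_zero (G : Geometry d X) (ε : ℝ) (K : PairExchange d)
    (ψ : EuclideanSpace ℝ d → ℝ) (r γ : ℝ) (φ : (Fin N → EuclideanSpace ℝ d) → ℝ)
    (ω : ℝ≥0 → Config N d X) : noiseMartingale G ε K ψ r γ φ ω 0 = 0 := by
  simp [noiseMartingale, collisionJumps]

variable [MeasurableSpace X]

/-- The **natural filtration** of the canonical process on `Traj G ε N`: `ℱ_s` is generated by the
coordinates `ω ↦ ω r`, `r ≤ s`. [folklore] -/
def trajFiltration (G : Geometry d X) (ε : ℝ) (N : ℕ) :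
    Filtration ℝ≥0 (inferInstance : MeasurableSpace (Traj G ε N)) where
  seq s := ⨆ r ∈ Set.Iic s, MeasurableSpace.comap (fun ω : Traj G ε N => ω.1 r) inferInstance
  mono' _ _ hst := biSup_mono fun _ hr => le_trans hr hst
  le' _ := iSup₂_le fun r _ => ((measurable_pi_apply r).comp measurable_subtype_coe).comap_le

/-- The coordinate map at time `r ≤ s` is `ℱ_s`-measurable. [folklore] -/
theorem measurable_apply_trajFiltration (G : Geometry d X) (ε : ℝ) (N : ℕ) {r s : ℝ≥0}
    (hrs : r ≤ s) : Measurable[trajFiltration G ε N s] fun ω : Traj G ε N => ω.1 r := by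
  refine Measurable.of_comap_le ?_
  exact le_iSup₂ (f := fun (r : ℝ≥0) (_ : r ∈ Set.Iic s) =>
    MeasurableSpace.comap (fun ω : Traj G ε N => ω.1 r) inferInstance) r hrs

end Paths

/-! ### The dynamics -/

section Dynamics

variable {X : Type*} [MeasureSpace X] [TopologicalSpace X] {N : ℕ}

/-- **Hard spheres with a conservative velocity-exchange noise** (Olla–Varadhan–Yau 1993 §1, §2.1;
Varadhan 1993 §5; Liverani–Olla 1996 §1): the Markov dynamics of `N` hard spheres of diameter `ε`
in the geometry `G` whose hard-sphere motion (streaming + elastic collisions) is superposed with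
the exchange noise of pair operator `K`, rate profile `ψ`, spatial scale `r` and strength `γ`
(generator "Liouville + `noiseGenerator G K ψ r γ`"), as a *hypothesis structure* bundling its
path-space laws: a Markov kernel `law z = P_z` on the canonical space `Traj G ε N` of stochastic
hard-sphere trajectories; a measurable, Liouville-conull `good` set of initial data in the
hard-sphere domain; and, for `z ∈ good`, (i) `P_z(ω_0 = z) = 1`, (ii) the simple Markov property
at deterministic times w.r.t. the natural filtration, (iii) the martingale problem: for every
smooth compactly supported `φ` of the velocities, `noiseMartingale G ε K ψ r γ φ` is a
`P_z`-martingale. Existence (well-posedness) is NOT part of the structure and is not asserted in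
this file; Mathlib has no SDE/PDMP with collisions to construct it. [cite: OllaVaradhanYau1993, §2.1 (2.4)–(2.6)] -/
structure BathExchangeDynamics (G : Geometry d X) (ε : ℝ) (N : ℕ) (K : PairExchange d)
    (ψ : EuclideanSpace ℝ d → ℝ) (r γ : ℝ) where
  /-- The law `P_z` of the path started at `z`, as a kernel into the canonical path space. -/
  law : Kernel (Config N d X) (Traj G ε N)
  /-- Each `P_z` is a probability measure. -/
  isMarkovKernel : IsMarkovKernel law
  /-- The good set of initial data. -/
  good : Set (Config N d X)
  /-- The good set is measurable. -/
  measurableSet_good : MeasurableSet good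
  /-- The good set lies in the hard-sphere domain. -/
  good_subset : good ⊆ hardSphereDomain G N ε
  /-- The good set has full Liouville measure. -/
  measure_compl_good : liouville G N ε goodᶜ = 0
  /-- The process starts at `z`: `P_z(ω_0 = z) = 1`. -/
  start : ∀ z ∈ good, ∀ᵐ ω ∂(law z), ω.1 0 = z
  /-- The simple Markov property at deterministic times for the natural filtration:
  `P_z(B ∩ θ_s⁻¹ A) = ∫_B P_{ω_s}(A) dP_z(ω)` for `B ∈ ℱ_s` (this is the only constraint on `law`
  at points outside `good`, e.g. contact configurations reached at collision times). -/
  markov : ∀ z ∈ good, ∀ (s : ℝ≥0) (A : Set (ℝ≥0 → Config N d X)), MeasurableSet A →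
    ∀ B : Set (Traj G ε N), MeasurableSet[trajFiltration G ε N s] B →
      law z (B ∩ {ω | pathShift s ω.1 ∈ A}) = ∫⁻ ω in B, law (ω.1 s) {ω' | ω'.1 ∈ A} ∂(law z)
  /-- The martingale problem for the velocity noise, collisions compensated explicitly. -/
  martingale : ∀ z ∈ good, ∀ φ : (Fin N → EuclideanSpace ℝ d) → ℝ,
    ContDiff ℝ (⊤ : ℕ∞) φ → HasCompactSupport φ →
      Martingale (fun (t : ℝ≥0) (ω : Traj G ε N) => noiseMartingale G ε K ψ r γ φ ω.1 t)
        (trajFiltration G ε N) (law z)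

namespace BathExchangeDynamics

variable {G : Geometry d X} {ε : ℝ} {K : PairExchange d} {ψ : EuclideanSpace ℝ d → ℝ} {r γ : ℝ}

/-- Each path law `P_z` is a probability measure (the structure field, as an instance). [folklore] -/
instance isMarkovKernel_law (S : BathExchangeDynamics G ε N K ψ r γ) : IsMarkovKernel S.law :=
  S.isMarkovKernel

/-- Liouville-almost every initial datum is good. [folklore] -/
theorem ae_mem_good (S : BathExchangeDynamics G ε N K ψ r γ) : ∀ᵐ z ∂liouville G N ε, z ∈ S.good :=
  S.measure_compl_good

/-- The **transition kernels** `P_t(z, ·)`: the law of `ω_t` under `P_z` (OVY 1993: the semigroup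
of the noisy generator; here the time-`t` marginal of the path law). [cite: OllaVaradhanYau1993, §2.1] -/
def kernel (S : BathExchangeDynamics G ε N K ψ r γ) (t : ℝ≥0) : Kernel (Config N d X) (Config N d X) :=
  S.law.map fun ω : Traj G ε N => ω.1 t

/-- The coordinate map at time `t` on the canonical path space is measurable. [folklore] -/
theorem measurable_traj_apply (G : Geometry d X) (ε : ℝ) (N : ℕ) (t : ℝ≥0) :
    Measurable fun ω : Traj G ε N => ω.1 t :=
  (measurable_pi_apply t).comp measurable_subtype_coe

/-- The transition kernel at time `t` applied to `z` is the time-`t` marginal of `P_z`. [folklore] -/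
theorem kernel_apply (S : BathExchangeDynamics G ε N K ψ r γ) (t : ℝ≥0) (z : Config N d X) :
    S.kernel t z = (S.law z).map fun ω : Traj G ε N => ω.1 t :=
  Kernel.map_apply _ (measurable_traj_apply G ε N t) z

/-- The transition kernels are Markov kernels. [folklore] -/
instance isMarkovKernel_kernel (S : BathExchangeDynamics G ε N K ψ r γ) (t : ℝ≥0) :
    IsMarkovKernel (S.kernel t) :=
  Kernel.IsMarkovKernel.map _ (measurable_traj_apply G ε N t)

/-- The **path law** of the process with initial law `P₀`: `∫ P_z P₀(dz)`. [folklore] -/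
def pathLaw (S : BathExchangeDynamics G ε N K ψ r γ) (P₀ : Measure (Config N d X)) :
    Measure (Traj G ε N) :=
  P₀.bind S.law

/-- The **law at time `t`** of the process with initial law `P₀`: `P₀ P_t = ∫ P_t(z, ·) P₀(dz)`
("the actual distribution at time `t` of our noisy evolution", the solution of the Fokker–Planck
equation `∂_t g = L^* g` whose relative entropy w.r.t. local Gibbs states Theorem 2.1 of OVY 1993
controls). [cite: OllaVaradhanYau1993, §2.3 Thm. 2.1] -/
def lawAt (S : BathExchangeDynamics G ε N K ψ r γ) (P₀ : Measure (Config N d X)) (t : ℝ≥0) :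
    Measure (Config N d X) :=
  P₀.bind (S.kernel t)

/-- Unfolding lemma for `pathLaw`. [folklore] -/
theorem pathLaw_eq (S : BathExchangeDynamics G ε N K ψ r γ) (P₀ : Measure (Config N d X)) :
    S.pathLaw P₀ = P₀.bind S.law := rfl

/-- Unfolding lemma for `lawAt`. [folklore] -/
theorem lawAt_eq (S : BathExchangeDynamics G ε N K ψ r γ) (P₀ : Measure (Config N d X)) (t : ℝ≥0) :
    S.lawAt P₀ t = P₀.bind (S.kernel t) := rfl

/-- The law at time `t` of a measurable set: `(P₀ P_t)(A) = ∫ P_z(ω_t ∈ A) P₀(dz)`. [folklore] -/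
theorem lawAt_apply (S : BathExchangeDynamics G ε N K ψ r γ) (P₀ : Measure (Config N d X)) (t : ℝ≥0)
    {A : Set (Config N d X)} (hA : MeasurableSet A) :
    S.lawAt P₀ t A = ∫⁻ z, S.law z {ω | ω.1 t ∈ A} ∂P₀ := by
  rw [lawAt_eq, Measure.bind_apply hA (Kernel.aemeasurable _)]
  refine lintegral_congr fun z => ?_
  rw [kernel_apply, Measure.map_apply (measurable_traj_apply G ε N t) hA]
  rfl

/-- The path law of a probability law is a probability measure. [folklore] -/
instance isProbabilityMeasure_pathLaw (S : BathExchangeDynamics G ε N K ψ r γ)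
    (P₀ : Measure (Config N d X)) [IsProbabilityMeasure P₀] : IsProbabilityMeasure (S.pathLaw P₀) := by
  change IsProbabilityMeasure (S.law ∘ₘ P₀)
  infer_instance

/-- The law at time `t` of a probability law is a probability measure. [folklore] -/
instance isProbabilityMeasure_lawAt (S : BathExchangeDynamics G ε N K ψ r γ)
    (P₀ : Measure (Config N d X)) [IsProbabilityMeasure P₀] (t : ℝ≥0) :
    IsProbabilityMeasure (S.lawAt P₀ t) := by
  change IsProbabilityMeasure (S.kernel t ∘ₘ P₀)
  infer_instance

/-- A measure `μ` on phase space is **invariant** (stationary) for the dynamics when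
`μ P_t = μ` for all `t ≥ 0` (Liverani–Olla 1996: stationary measures of the Hamiltonian dynamics
with conservative noise). A definition, not an assertion: that the hard-sphere Gibbs measures are
invariant for a conservative `K` is a theorem about the dynamics. [cite: LiveraniOlla1996, §1] -/
def IsInvariant (S : BathExchangeDynamics G ε N K ψ r γ) (μ : Measure (Config N d X)) : Prop :=
  ∀ t : ℝ≥0, μ.bind (S.kernel t) = μ

/-- Under an invariant law the law at every time is the initial law. [folklore] -/
theorem lawAt_eq_self_of_isInvariant (S : BathExchangeDynamics G ε N K ψ r γ)
    {μ : Measure (Config N d X)} (h : S.IsInvariant μ) (t : ℝ≥0) : S.lawAt μ t = μ :=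
  h t

/-- Expectations of path functionals under `P_z` started from an initial law: the path law
integrates `P_z` against `P₀` (measurable sets). [folklore] -/
theorem pathLaw_apply (S : BathExchangeDynamics G ε N K ψ r γ) (P₀ : Measure (Config N d X))
    {A : Set (Traj G ε N)} (hA : MeasurableSet A) :
    S.pathLaw P₀ A = ∫⁻ z, S.law z A ∂P₀ :=
  Measure.bind_apply hA (Kernel.aemeasurable _)

end BathExchangeDynamics

end Dynamics

end Literature.MathematicalPhysics.KineticTheory
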